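import Literature.Analysis.FluidPDE.Wei2016SupLemma
import HarnessLib

/-!
# SHEET-ℝ frame: the sup bound from the energy norm, `|δ(x)| ≤ √2·‖δ‖_E / L`

HONEST FRAMING (cell ns-blowup GROUP B / zone Z3, case Z3-SR-CERT; 1-D MODEL certificate frame; not Euler/NS).

The SHEET-ℝ certificate (profile-lead RULING (ay); cert-1 SHEET-R-PRICE-impl1.md §1/§2 (C4)–(C5); selfsim FRAME-NOTE-v2 §1 (1d)) works in the energy
norm `‖δ‖²_E := ∫(L² + ξ²)·(δ′² + ¼δ²)` (`w = L² + ξ²`) and reports SUP-NORM enclosures of the certified profile via `sup|δ| ≤ √2·‖δ‖_E/L`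
(«sup|Ω* − Ω̄| ≤ r√2/L»). This file makes that step a kernel lemma: the tree's 1-D Agmon inequality `Wei2016.sq_le_two_mul_integral_abs_mul`
(`g(x)² ≤ 2∫|g·g′|`) plus the pointwise AM–GM bound `|δ·δ′| ≤ ¼δ² + δ′² ≤ w·(δ′² + ¼δ²)/L²` give

  `δ(x)² ≤ (2/L²)·‖δ‖²_E`   (`sq_le_energy`),   `|δ(x)| ≤ (√2/L)·‖δ‖_E`   (`abs_le_sqrt_two_div_mul_energy`)

for every `δ ∈ C¹(ℝ)` with `w·δ², w·δ′² ∈ L¹`. Pure calculus; no definition, no named fact; MODEL frame bookkeeping only.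
-/

noncomputable section

namespace Summit.NavierStokesRegularity.OSWSelfSimilar
namespace SheetREnergySupBound

open _root_.MeasureTheory _root_.Set _root_.Filter
open scoped Real Topology

/-- **`δ(x)² ≤ (2/L²)·∫ (L² + y²)(δ′(y)² + ¼δ(y)²) dy`** for `δ ∈ C¹` with weighted-square-integrable `δ`, `δ′` (`L > 0`). [folklore] -/
theorem sq_le_energy {δ δ' : ℝ → ℝ} {L : ℝ} (hL : 0 < L) (hd : ∀ x, HasDerivAt δ (δ' x) x)
    (h0 : Integrable (fun y => (L ^ 2 + y ^ 2) * δ y ^ 2)) (h1 : Integrable (fun y => (L ^ 2 + y ^ 2) * δ' y ^ 2)) (x : ℝ) :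
    δ x ^ 2 ≤ 2 / L ^ 2 * ∫ y, (L ^ 2 + y ^ 2) * (δ' y ^ 2 + 1 / 4 * δ y ^ 2) := by
  have hL2 : 0 < L ^ 2 := by positivity
  have hδc : Continuous δ := continuous_iff_continuousAt.2 fun y => (hd y).continuousAt
  have hδ'm : AEStronglyMeasurable δ' volume := by
    have e : δ' = deriv δ := funext fun y => ((hd y).deriv).symm
    rw [e]
    exact (measurable_deriv δ).aestronglyMeasurable
  -- weight ≥ L²: unweighted squares are integrable
  have hw : ∀ y : ℝ, L ^ 2 ≤ L ^ 2 + y ^ 2 := fun y => by nlinarith [sq_nonneg y]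
  have hi0 : Integrable (fun y => δ y ^ 2) := by
    refine (h0.const_mul (1 / L ^ 2)).mono' ((hδc.pow 2).aestronglyMeasurable) (Eventually.of_forall fun y => ?_)
    rw [Real.norm_eq_abs, abs_of_nonneg (sq_nonneg _)]
    calc δ y ^ 2 = 1 / L ^ 2 * (L ^ 2 * δ y ^ 2) := by field_simp
      _ ≤ 1 / L ^ 2 * ((L ^ 2 + y ^ 2) * δ y ^ 2) :=
          mul_le_mul_of_nonneg_left (mul_le_mul_of_nonneg_right (hw y) (sq_nonneg _)) (by positivity)
  have hi1 : Integrable (fun y => δ' y ^ 2) := by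
    refine (h1.const_mul (1 / L ^ 2)).mono' ?_ (Eventually.of_forall fun y => ?_)
    · exact (hδ'm.pow 2 : AEStronglyMeasurable (fun y => δ' y ^ 2) volume)
    · rw [Real.norm_eq_abs, abs_of_nonneg (sq_nonneg _)]
      calc δ' y ^ 2 = 1 / L ^ 2 * (L ^ 2 * δ' y ^ 2) := by field_simp
        _ ≤ 1 / L ^ 2 * ((L ^ 2 + y ^ 2) * δ' y ^ 2) :=
            mul_le_mul_of_nonneg_left (mul_le_mul_of_nonneg_right (hw y) (sq_nonneg _)) (by positivity)
  -- Agmon (tree): δ(x)² ≤ 2 ∫ |δ δ′|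
  have hA := Literature.Analysis.FluidPDE.Wei2016.sq_le_two_mul_integral_abs_mul hd hi0 hi1 x
  -- pointwise AM–GM with the weight
  have hpt : ∀ y, |δ y * δ' y| ≤ 1 / L ^ 2 * ((L ^ 2 + y ^ 2) * (δ' y ^ 2 + 1 / 4 * δ y ^ 2)) := by
    intro y
    have h2 : |δ y * δ' y| ≤ δ' y ^ 2 + 1 / 4 * δ y ^ 2 := by
      rw [abs_mul]
      nlinarith [sq_nonneg (|δ y| / 2 - |δ' y|), sq_abs (δ y), sq_abs (δ' y), abs_nonneg (δ y), abs_nonneg (δ' y)]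
    have h3 : δ' y ^ 2 + 1 / 4 * δ y ^ 2 ≤ 1 / L ^ 2 * ((L ^ 2 + y ^ 2) * (δ' y ^ 2 + 1 / 4 * δ y ^ 2)) := by
      have hq : 0 ≤ δ' y ^ 2 + 1 / 4 * δ y ^ 2 := by positivity
      calc δ' y ^ 2 + 1 / 4 * δ y ^ 2 = 1 / L ^ 2 * (L ^ 2 * (δ' y ^ 2 + 1 / 4 * δ y ^ 2)) := by field_simp
        _ ≤ 1 / L ^ 2 * ((L ^ 2 + y ^ 2) * (δ' y ^ 2 + 1 / 4 * δ y ^ 2)) :=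
            mul_le_mul_of_nonneg_left (mul_le_mul_of_nonneg_right (hw y) hq) (by positivity)
    exact h2.trans h3
  -- integrability of the weighted energy density and of |δδ′|
  have hE : Integrable (fun y => (L ^ 2 + y ^ 2) * (δ' y ^ 2 + 1 / 4 * δ y ^ 2)) := by
    have := h1.add (h0.const_mul (1 / 4))
    refine this.congr (Eventually.of_forall fun y => ?_)
    simp only [Pi.add_apply]
    ring
  have hprod : Integrable (fun y => |δ y * δ' y|) := by
    refine (hE.const_mul (1 / L ^ 2)).mono' ((hδc.aestronglyMeasurable.mul hδ'm).norm) (Eventually.of_forall fun y => ?_)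
    rw [Real.norm_eq_abs, abs_abs]
    exact hpt y
  have hmono : ∫ y, |δ y * δ' y| ≤ ∫ y, 1 / L ^ 2 * ((L ^ 2 + y ^ 2) * (δ' y ^ 2 + 1 / 4 * δ y ^ 2)) :=
    integral_mono hprod (hE.const_mul (1 / L ^ 2)) hpt
  rw [integral_const_mul] at hmono
  calc δ x ^ 2 ≤ 2 * ∫ y, |δ y * δ' y| := hA
    _ ≤ 2 * (1 / L ^ 2 * ∫ y, (L ^ 2 + y ^ 2) * (δ' y ^ 2 + 1 / 4 * δ y ^ 2)) := by linarith
    _ = 2 / L ^ 2 * ∫ y, (L ^ 2 + y ^ 2) * (δ' y ^ 2 + 1 / 4 * δ y ^ 2) := by ring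

/-- **`|δ(x)| ≤ (√2/L)·‖δ‖_E`**, `‖δ‖_E := (∫ (L² + y²)(δ′² + ¼δ²))^{1/2}` — the sup-norm enclosure step of the SHEET-ℝ certificate
(«sup|Ω* − Ω̄| ≤ r√2/L»). [folklore] -/
theorem abs_le_sqrt_two_div_mul_energy {δ δ' : ℝ → ℝ} {L : ℝ} (hL : 0 < L) (hd : ∀ x, HasDerivAt δ (δ' x) x)
    (h0 : Integrable (fun y => (L ^ 2 + y ^ 2) * δ y ^ 2)) (h1 : Integrable (fun y => (L ^ 2 + y ^ 2) * δ' y ^ 2)) (x : ℝ) :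
    |δ x| ≤ Real.sqrt 2 / L * Real.sqrt (∫ y, (L ^ 2 + y ^ 2) * (δ' y ^ 2 + 1 / 4 * δ y ^ 2)) := by
  have h := sq_le_energy hL hd h0 h1 x
  have hEpos : 0 ≤ ∫ y, (L ^ 2 + y ^ 2) * (δ' y ^ 2 + 1 / 4 * δ y ^ 2) :=
    integral_nonneg fun y => by positivity
  have h2 : |δ x| = Real.sqrt (δ x ^ 2) := (Real.sqrt_sq_eq_abs _).symm
  rw [h2]
  calc Real.sqrt (δ x ^ 2) ≤ Real.sqrt (2 / L ^ 2 * ∫ y, (L ^ 2 + y ^ 2) * (δ' y ^ 2 + 1 / 4 * δ y ^ 2)) :=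
        Real.sqrt_le_sqrt h
    _ = Real.sqrt 2 / L * Real.sqrt (∫ y, (L ^ 2 + y ^ 2) * (δ' y ^ 2 + 1 / 4 * δ y ^ 2)) := by
        rw [Real.sqrt_mul (by positivity), Real.sqrt_div (by norm_num : (0 : ℝ) ≤ 2), Real.sqrt_sq hL.le]

/-- If the energy norm is bounded by `r`, the sup norm is bounded by `√2·r/L`. [folklore] -/
theorem abs_le_of_energy_le {δ δ' : ℝ → ℝ} {L r : ℝ} (hL : 0 < L) (hd : ∀ x, HasDerivAt δ (δ' x) x)
    (h0 : Integrable (fun y => (L ^ 2 + y ^ 2) * δ y ^ 2)) (h1 : Integrable (fun y => (L ^ 2 + y ^ 2) * δ' y ^ 2))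
    (hr : Real.sqrt (∫ y, (L ^ 2 + y ^ 2) * (δ' y ^ 2 + 1 / 4 * δ y ^ 2)) ≤ r) (x : ℝ) :
    |δ x| ≤ Real.sqrt 2 / L * r :=
  (abs_le_sqrt_two_div_mul_energy hL hd h0 h1 x).trans (mul_le_mul_of_nonneg_left hr (by positivity))

end SheetREnergySupBound
end Summit.NavierStokesRegularity.OSWSelfSimilar

end
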